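/-
Copyright: internal research formalization. Source texts: G. Kempf, F. Knudsen, D. Mumford,
B. Saint-Donat, Toroidal Embeddings I (LNM 339, Springer 1973) [KempfEtAl1973], Ch. I §2
(Theorems 10, 11 and the proof of Theorem 11 with its Lemmas 1–2); W. Fulton, Introduction to
Toric Varieties [Fulton1993Toric], §1.2 (faces and dual faces), §1.4 (the fan of faces of a
cone), §2.6 p. 47 (star subdivision).
-/
import Mathlib
import HarnessLib
import Literature.Geometry.PolyhedralFans.StarSubdivision
import Literature.Geometry.PolyhedralFans.SimplicialGenerators

/-!
# Support functions on fans, I: the face fan of a cone, exposed faces, the `v`-coordinate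

Topic: `Literature/Geometry/PolyhedralFans` (continuation of `StarSubdivision`,
`RegularRefinement`). This file prepares the proof that the regular refinement by iterated star
subdivisions is **projective**, i.e. carried by an integral strictly convex piecewise-linear
function ([KempfEtAl1973] I §2 Thm. 11: "there exists a `T`-invariant sheaf of ideals `𝔉` such
that `B_𝔉(X)` is non singular", proved by constructing "a function `f` … piecewise linear convex
rational … such that the associated polyhedra are simplices of multiplicity 1").

## Content (all PROVED; no named facts)

* `isFaceOf_trans`; `Fan.ofCone σ` — **the fan of all faces of a polyhedral salient cone**
  ([Fulton1993Toric] §1.4: "If `σ` is a cone in `N`, and `Δ` consists of `σ` together with all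
  of its faces, then `Δ` is a fan");
* `exists_dotProduct_exposing` — **every face of a polyhedral cone in `κ → 𝕜` is
  exposed**: there is `a` with `a · x ≥ 0` on `σ` and `σ ∩ {a · x = 0} = τ` ([Fulton1993Toric]
  §1.2: "A face `τ` of `σ` is the intersection of `σ` with any supporting hyperplane:
  `τ = σ ∩ u^⊥` … for some `u` in `σ^∨`");
* `Fan.starCoord Δ v x` — the `v`-coordinate of `x` with respect to the star subdivision of `Δ`
  through `v` (the function `g` of [KempfEtAl1973] I §2 Lemma 2 (b): "`g` is a linear function
  such that `g(x₀) = 1` and `g | τᵢ = 0`" on each new cone `⟨x₀, τᵢ⟩`, `0` off the star of `x₀`),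
  with `starCoord_eq` (value `c` at `t + c v`), `starCoord_of_not_mem` (vanishing on the cones not
  containing `v`), `exists_eq_add_starCoord_smul` (decomposition inside a cone containing `v`);
* `Fan.SupportData Δ` — the data of a **strictly convex piecewise-linear support function** on a
  fan: a function `f` with a linear piece `a_τ` on every cone, `f ≤ a_τ` on the support, and the
  locus `{f = a_τ}` a cone of the fan ("the biggest polyhedra on which `f` is linear" are the cones,
  [KempfEtAl1973] I §2 Thm. 10 and proof of Thm. 11 (2)); `Fan.SupportData.ofCone` — the zero function on the
  face fan of a cone.

Part II (`ProjectiveSubdivision`) proves that `SupportData` survives star subdivisions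
([KempfEtAl1973] I §2 Lemma 2) and concludes.
-/

noncomputable section

namespace Literature.Geometry.PolyhedralFans

open PointedCone Finset

variable {𝕜 : Type*} [Field 𝕜] [LinearOrder 𝕜] [IsStrictOrderedRing 𝕜]
variable {V : Type*} [AddCommGroup V] [Module 𝕜 V]

/-! ## Faces of faces; the face fan of a cone -/

/-- A face of a face is a face. [cite: Fulton1993Toric, §1.2 (4)] -/
theorem isFaceOf_trans {F τ σ : PointedCone 𝕜 V} (hF : F.IsFaceOf τ) (hτ : τ.IsFaceOf σ) :
    F.IsFaceOf σ := by
  refine IsFaceOf.of_mem_of_add_mem_left (hF.le.trans hτ.le) fun {x y} hx hy hxy => ?_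
  have hxτ : x ∈ τ := hτ.mem_of_add_mem_left hx hy (hF.le hxy)
  have hyτ : y ∈ τ := hτ.mem_of_add_mem_right hx hy (hF.le hxy)
  exact hF.mem_of_add_mem_left hxτ hyτ hxy

/-- A face of a finitely generated cone is finitely generated (it is generated by the generators
it contains). [cite: Fulton1993Toric, §1.2 (4)] -/
theorem isFaceOf_fg_of_fg {τ σ : PointedCone 𝕜 V} (hτ : τ.IsFaceOf σ) (hσ : σ.FG) : τ.FG := by
  classical
  obtain ⟨S, hS⟩ := hσ
  have hτ' : τ.IsFaceOf (PointedCone.hull 𝕜 (S : Set V)) := by rw [PointedCone.hull, hS]; exact hτ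
  exact ⟨S.filter (· ∈ τ), (eq_hull_filter_of_isFaceOf_hull hτ').symm⟩

/-- A finitely generated cone has finitely many faces. [cite: Fulton1993Toric, §1.2 (4)] -/
theorem finite_setOf_isFaceOf {σ : PointedCone 𝕜 V} (hσ : σ.FG) :
    {τ : PointedCone 𝕜 V | τ.IsFaceOf σ}.Finite := by
  classical
  obtain ⟨S, hS⟩ := hσ
  refine (S.powerset.finite_toSet.image fun T : Finset V => PointedCone.hull 𝕜 (T : Set V)).subset
    ?_
  intro τ hτ
  have hτ' : τ.IsFaceOf (PointedCone.hull 𝕜 (S : Set V)) := by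
    rw [PointedCone.hull, hS]; exact hτ
  refine ⟨S.filter (· ∈ τ), ?_, (eq_hull_filter_of_isFaceOf_hull hτ').symm⟩
  simp only [Finset.coe_powerset, Set.mem_preimage, Set.mem_powerset_iff, Finset.coe_subset]
  exact Finset.filter_subset _ _

/-- **The face fan of a cone** ("If `σ` is a cone in `N`, and `Δ` consists of `σ` together with all
of its faces, then `Δ` is a fan"): a polyhedral salient cone with all its faces.
[cite: Fulton1993Toric, §1.4] -/
def Fan.ofCone (σ : PointedCone 𝕜 V) (hfg : σ.FG) (hsal : IsSalient σ) : Fan 𝕜 V where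
  cones := {τ | τ.IsFaceOf σ}
  finite := finite_setOf_isFaceOf hfg
  fg := fun _ hτ => isFaceOf_fg_of_fg hτ hfg
  salient := fun _ hτ => hsal.anti hτ.le
  face_mem := fun _ hτ _ hF => isFaceOf_trans hF hτ
  inf_isFaceOf := fun _ h₁ _ h₂ =>
    (IsFaceOf.isFaceOf_iff_le (h₁.inf_left h₂) h₁).mpr inf_le_left

/-- The cones of the face fan are the faces. [cite: Fulton1993Toric, §1.4] -/
@[simp] theorem Fan.mem_ofCone_iff {σ : PointedCone 𝕜 V} {hfg : σ.FG} {hsal : IsSalient σ}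
    {τ : PointedCone 𝕜 V} : τ ∈ (Fan.ofCone σ hfg hsal).cones ↔ τ.IsFaceOf σ := Iff.rfl

/-- The cone itself belongs to its face fan. [cite: Fulton1993Toric, §1.4] -/
theorem Fan.self_mem_ofCone {σ : PointedCone 𝕜 V} (hfg : σ.FG) (hsal : IsSalient σ) :
    σ ∈ (Fan.ofCone σ hfg hsal).cones := IsFaceOf.refl σ

/-- The support of the face fan of `σ` is `σ`. [cite: Fulton1993Toric, §1.4] -/
theorem Fan.support_ofCone {σ : PointedCone 𝕜 V} (hfg : σ.FG) (hsal : IsSalient σ) :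
    (Fan.ofCone σ hfg hsal).support = (σ : Set V) := by
  apply le_antisymm
  · intro x hx
    obtain ⟨τ, hτ, hxτ⟩ := Fan.mem_support.mp hx
    exact (Fan.mem_ofCone_iff.mp hτ).le hxτ
  · intro x hx
    exact Fan.mem_support.mpr ⟨σ, Fan.self_mem_ofCone hfg hsal, hx⟩

/-! ## Faces of polyhedral cones are exposed -/

section Exposed

open Matrix Literature.Analysis.Convex.FarkasMinkowskiWeyl

variable {κ : Type*} [Fintype κ]

/-- A nonnegative-scalar multiple, as an element of a pointed cone. [cite: Fulton1993Toric, §1.2 p. 9] -/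
theorem smul_mem_of_nonneg {σ : PointedCone 𝕜 V} {x : V} (hx : x ∈ σ) {c : 𝕜} (hc : 0 ≤ c) :
    c • x ∈ σ := by
  have := Submodule.smul_mem σ (⟨c, hc⟩ : {c : 𝕜 // 0 ≤ c}) hx
  simpa using this

/-- **Every face of a polyhedral cone is exposed** ([Fulton1993Toric] §1.2: the faces of `σ` are
the sets `σ ∩ u^⊥`, `u ∈ σ^∨`): for a face `τ` of a finitely generated cone `σ ⊆ κ → 𝕜` there is a
vector `a` with `a · x ≥ 0` on `σ` and `τ = {x ∈ σ | a · x = 0}`. Proof: write `σ` as a finite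
intersection of half-spaces `{b · x ≥ 0}` (Minkowski–Weyl) and take `a` = the sum of those `b`
vanishing on `τ`; if `x ∈ σ` has `a · x = 0` then `N y − x ∈ σ` for `y` the sum of the
generators of `τ` and `N` large, so `x ∈ τ` by the face property. [cite: Fulton1993Toric, §1.2 (2)] -/
theorem exists_dotProduct_exposing {σ τ : PointedCone 𝕜 (κ → 𝕜)} (hτσ : τ.IsFaceOf σ)
    (hσ : σ.FG) :
    ∃ a : κ → 𝕜, (∀ x ∈ σ, 0 ≤ a ⬝ᵥ x) ∧ ∀ x ∈ σ, a ⬝ᵥ x = 0 ↔ x ∈ τ := by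
  classical
  obtain ⟨s, hs⟩ := (fg_iff_dualFG_dotProduct σ).mp hσ
  have hmem : ∀ y : κ → 𝕜, y ∈ σ ↔ ∀ b ∈ s, 0 ≤ b ⬝ᵥ y := by
    intro y
    rw [← hs, PointedCone.mem_dual]
    simp only [Finset.mem_coe, dotProductBilin_apply_apply]
  obtain ⟨G, hG⟩ := isFaceOf_fg_of_fg hτσ hσ
  have hGτ : ∀ g ∈ G, g ∈ τ := fun g hg => hG ▸ Submodule.subset_span hg
  -- the defining forms vanishing on `τ`
  set s₀ := s.filter fun b => ∀ g ∈ G, b ⬝ᵥ g = 0 with hs₀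
  have hs₀τ : ∀ b ∈ s₀, ∀ x ∈ τ, b ⬝ᵥ x = 0 := by
    intro b hb x hx
    have hb' : ∀ g ∈ G, b ⬝ᵥ g = 0 := (Finset.mem_filter.mp hb).2
    rw [← hG] at hx
    induction hx using Submodule.span_induction with
    | mem g hg => exact hb' g hg
    | zero => simp
    | add x y _ _ hx hy => rw [dotProduct_add, hx, hy, add_zero]
    | smul c x _ hx =>
      rw [show (c • x : κ → 𝕜) = (c : 𝕜) • x from rfl, dotProduct_smul, hx, smul_zero]
  refine ⟨∑ b ∈ s₀, b, fun x hx => ?_, fun x hx => ⟨fun h0 => ?_, fun hxτ => ?_⟩⟩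
  · rw [sum_dotProduct]
    exact Finset.sum_nonneg fun b hb => (hmem x).mp hx b (Finset.mem_filter.mp hb).1
  · -- each vanishing form vanishes at `x`
    have h0' : ∀ b ∈ s₀, b ⬝ᵥ x = 0 := by
      have := (Finset.sum_eq_zero_iff_of_nonneg fun b hb =>
        (hmem x).mp hx b (Finset.mem_filter.mp hb).1).mp (by rwa [sum_dotProduct] at h0)
      exact this
    -- an interior point of `τ`
    set y : κ → 𝕜 := ∑ g ∈ G, g with hy
    have hyτ : y ∈ τ := Submodule.sum_mem _ fun g hg => hGτ g hg
    have hpos : ∀ b ∈ s, b ∉ s₀ → 0 < b ⬝ᵥ y := by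
      intro b hb hb0
      have hnn : ∀ g ∈ G, 0 ≤ b ⬝ᵥ g := fun g hg => (hmem g).mp (hτσ.le (hGτ g hg)) b hb
      have hex : ∃ g ∈ G, b ⬝ᵥ g ≠ 0 := by
        by_contra hall
        push Not at hall
        exact hb0 (Finset.mem_filter.mpr ⟨hb, hall⟩)
      obtain ⟨g, hg, hg0⟩ := hex
      rw [hy, dotProduct_sum]
      exact Finset.sum_pos' (fun g hg => hnn g hg) ⟨g, hg, lt_of_le_of_ne (hnn g hg) hg0.symm⟩
    -- `N y - x ∈ σ` for `N` large
    set N : 𝕜 := ∑ b ∈ s, if b ∈ s₀ then 0 else b ⬝ᵥ x / (b ⬝ᵥ y) with hN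
    have hNterm : ∀ b ∈ s, b ∉ s₀ → b ⬝ᵥ x / (b ⬝ᵥ y) ≤ N := by
      intro b hb hb0
      rw [hN]
      refine Finset.single_le_sum (f := fun b => if b ∈ s₀ then 0 else b ⬝ᵥ x / (b ⬝ᵥ y))
        (fun b' hb' => ?_) hb |>.trans_eq' (by simp [hb0])
      split_ifs with h
      · exact le_rfl
      · exact div_nonneg ((hmem x).mp hx b' hb') (hpos b' hb' h).le
    have hN0 : 0 ≤ N :=
      Finset.sum_nonneg fun b hb => by
        split_ifs with h
        · exact le_rfl
        · exact div_nonneg ((hmem x).mp hx b hb) (hpos b hb h).le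
    have hw : N • y - x ∈ σ := by
      rw [hmem]
      intro b hb
      rw [dotProduct_sub, dotProduct_smul, smul_eq_mul, sub_nonneg]
      by_cases hb0 : b ∈ s₀
      · rw [h0' b hb0, hs₀τ b hb0 y hyτ, mul_zero]
      · have := hNterm b hb hb0
        rwa [div_le_iff₀ (hpos b hb hb0)] at this
    have hsum : x + (N • y - x) ∈ τ := by
      rw [add_sub_cancel]
      exact smul_mem_of_nonneg hyτ hN0
    exact hτσ.mem_of_add_mem_left hx hw hsum
  · rw [sum_dotProduct]
    exact Finset.sum_eq_zero fun b hb => hs₀τ b hb x hxτ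

/-- Exposing functional normalised at a vector off the face: for `v ∈ σ ∖ τ` there is `a` with
`a · x ≥ 0` on `σ`, `τ = σ ∩ {a · x = 0}` and `a · v = 1`. [cite: Fulton1993Toric, §1.2 (2)] -/
theorem exists_dotProduct_exposing_eq_one {σ τ : PointedCone 𝕜 (κ → 𝕜)}
    (hτσ : τ.IsFaceOf σ) (hσ : σ.FG) {v : κ → 𝕜} (hv : v ∈ σ) (hvτ : v ∉ τ) :
    ∃ a : κ → 𝕜, (∀ x ∈ σ, 0 ≤ a ⬝ᵥ x) ∧ (∀ x ∈ σ, a ⬝ᵥ x = 0 ↔ x ∈ τ) ∧ a ⬝ᵥ v = 1 := by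
  obtain ⟨a, ha, haτ⟩ := exists_dotProduct_exposing hτσ hσ
  have hav : 0 < a ⬝ᵥ v := lt_of_le_of_ne (ha v hv) fun h => hvτ ((haτ v hv).mp h.symm)
  refine ⟨(a ⬝ᵥ v)⁻¹ • a, fun x hx => ?_, fun x hx => ?_, ?_⟩
  · rw [smul_dotProduct, smul_eq_mul]
    exact mul_nonneg (inv_nonneg.mpr hav.le) (ha x hx)
  · rw [smul_dotProduct, smul_eq_mul, mul_eq_zero, ← haτ x hx]
    simp [hav.ne']
  · rw [smul_dotProduct, smul_eq_mul, inv_mul_cancel₀ hav.ne']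

end Exposed

/-! ## The `v`-coordinate with respect to a star subdivision -/

section StarCoord

open Matrix

variable {κ : Type*}

namespace Fan

variable (Δ : Fan 𝕜 (κ → 𝕜))

/-- `x = t + c v` is a **star decomposition** of `x` with respect to `v`: `t` lies in a cone `τ ∌ v`
of `Δ` which is contained in a cone `σ ∋ v` of `Δ`, and `c ≥ 0` (so `x` lies in the new cone
`τ + 𝕜_{≥0} v` of the star subdivision). [cite: KempfEtAl1973, I §2 Thm. 11 proof, Lemma 2] -/
def IsStarDecomp (v x : κ → 𝕜) (c : 𝕜) : Prop :=
  ∃ σ ∈ Δ.cones, v ∈ σ ∧ ∃ τ ∈ Δ.cones, v ∉ τ ∧ τ ≤ σ ∧ ∃ t ∈ τ, 0 ≤ c ∧ x = t + c • v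

variable {Δ}

/-- The coefficient of `v` in a star decomposition is unique (the new cones form a fan and the
`v`-coordinate on `τ + 𝕜_{≥0} v` is well defined). [cite: KempfEtAl1973, I §2 Thm. 11 proof, Lemma 2 (a)] -/
theorem IsStarDecomp.unique {v x : κ → 𝕜} {c c' : 𝕜} (h : Δ.IsStarDecomp v x c)
    (h' : Δ.IsStarDecomp v x c') : c = c' := by
  obtain ⟨σ₁, hσ₁, hv₁, τ₁, hτ₁, hvτ₁, h₁, t₁, ht₁, hc, hx₁⟩ := h
  obtain ⟨σ₂, hσ₂, hv₂, τ₂, hτ₂, hvτ₂, h₂, t₂, ht₂, hc', hx₂⟩ := h'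
  have hx : x ∈ (τ₁ ⊔ ray 𝕜 v) ⊓ (τ₂ ⊔ ray 𝕜 v) :=
    Submodule.mem_inf.mpr ⟨hx₁ ▸ add_smul_mem_sup_ray ht₁ hc, hx₂ ▸ add_smul_mem_sup_ray ht₂ hc'⟩
  rw [Fan.sup_ray_inf_sup_ray_eq hτ₁ hvτ₁ hσ₁ h₁ hv₁ hτ₂ hvτ₂ hσ₂ h₂ hv₂] at hx
  obtain ⟨t, ht, c'', -, hx''⟩ := mem_sup_ray_iff.mp hx
  have e₁ := eq_and_eq_of_add_smul_eq (Δ.isFaceOf_of_le hσ₁ hτ₁ h₁) hv₁ hvτ₁ ht₁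
    (Submodule.mem_inf.mp ht).1 (hx₁.symm.trans hx'')
  have e₂ := eq_and_eq_of_add_smul_eq (Δ.isFaceOf_of_le hσ₂ hτ₂ h₂) hv₂ hvτ₂ ht₂
    (Submodule.mem_inf.mp ht).2 (hx₂.symm.trans hx'')
  exact e₁.1.trans e₂.1.symm

variable (Δ)

open Classical in
/-- **The `v`-coordinate** of `x` with respect to the star subdivision of `Δ` through `v`: the
coefficient `c` of a star decomposition `x = t + c v` when `x` lies in a cone of `Δ` containing `v`,
and `0` otherwise (the function `g` of [KempfEtAl1973] I §2 Lemma 2 (b), glued over the star of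
`v` and extended by `0`). [cite: KempfEtAl1973, I §2 Thm. 11 proof, Lemma 2 (b)] -/
def starCoord (v x : κ → 𝕜) : 𝕜 :=
  if h : ∃ c, Δ.IsStarDecomp v x c then h.choose else 0

variable {Δ}

/-- The `v`-coordinate of a star decomposition is its coefficient.
[cite: KempfEtAl1973, I §2 Thm. 11 proof, Lemma 2 (b)] -/
theorem starCoord_eq_of_isStarDecomp {v x : κ → 𝕜} {c : 𝕜} (h : Δ.IsStarDecomp v x c) :
    Δ.starCoord v x = c := by
  have hex : ∃ c, Δ.IsStarDecomp v x c := ⟨c, h⟩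
  rw [starCoord, dif_pos hex]
  exact hex.choose_spec.unique h

/-- `starCoord v (t + c v) = c` for `t ∈ τ ∌ v`, `τ ⊆ σ ∋ v` cones of `Δ`, `c ≥ 0`.
[cite: KempfEtAl1973, I §2 Thm. 11 proof, Lemma 2 (b)] -/
theorem starCoord_eq {v : κ → 𝕜} {σ τ : PointedCone 𝕜 (κ → 𝕜)} (hσ : σ ∈ Δ.cones) (hv : v ∈ σ)
    (hτ : τ ∈ Δ.cones) (hvτ : v ∉ τ) (hτσ : τ ≤ σ) {t : κ → 𝕜} (ht : t ∈ τ) {c : 𝕜}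
    (hc : 0 ≤ c) : Δ.starCoord v (t + c • v) = c :=
  starCoord_eq_of_isStarDecomp ⟨σ, hσ, hv, τ, hτ, hvτ, hτσ, t, ht, hc, rfl⟩

/-- The `v`-coordinate is non-negative. [cite: KempfEtAl1973, I §2 Thm. 11 proof, Lemma 2 (b)] -/
theorem starCoord_nonneg (v x : κ → 𝕜) : 0 ≤ Δ.starCoord v x := by
  by_cases hex : ∃ c, Δ.IsStarDecomp v x c
  · obtain ⟨c, h⟩ := hex
    rw [starCoord_eq_of_isStarDecomp h]
    obtain ⟨_, _, _, _, _, _, _, _, _, hc, _⟩ := h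
    exact hc
  · rw [starCoord, dif_neg hex]

/-- The `v`-coordinate vanishes on every cone of `Δ` not containing `v` ("`g | τᵢ = 0`").
[cite: KempfEtAl1973, I §2 Thm. 11 proof, Lemma 2 (b)] -/
theorem starCoord_of_not_mem {v x : κ → 𝕜} {η : PointedCone 𝕜 (κ → 𝕜)} (hη : η ∈ Δ.cones)
    (hvη : v ∉ η) (hx : x ∈ η) : Δ.starCoord v x = 0 := by
  by_cases hex : ∃ c, Δ.IsStarDecomp v x c
  · obtain ⟨c, σ, hσ, hv, τ, hτ, hvτ, hτσ, t, ht, hc, hxe⟩ := hex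
    have hxσ : x ∈ σ := by
      rw [hxe]; exact σ.add_mem (hτσ ht) (smul_mem_of_nonneg hv hc)
    have hτ' : σ ⊓ η ∈ Δ.cones := Δ.face_mem hσ (Δ.inf_isFaceOf hσ hη)
    have h0 : Δ.IsStarDecomp v x 0 :=
      ⟨σ, hσ, hv, σ ⊓ η, hτ', fun h => hvη (Submodule.mem_inf.mp h).2, inf_le_left, x,
        Submodule.mem_inf.mpr ⟨hxσ, hx⟩, le_rfl, by simp⟩
    exact starCoord_eq_of_isStarDecomp h0
  · rw [starCoord, dif_neg hex]

/-- The `v`-coordinate vanishes off the star of `v`. [cite: KempfEtAl1973, I §2 Thm. 11 proof, Lemma 2 (b)] -/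
theorem starCoord_of_forall_not_mem {v x : κ → 𝕜}
    (h : ∀ σ ∈ Δ.cones, v ∈ σ → x ∉ σ) : Δ.starCoord v x = 0 := by
  have hex : ¬ ∃ c, Δ.IsStarDecomp v x c := by
    rintro ⟨c, σ, hσ, hv, τ, -, -, hτσ, t, ht, hc, hxe⟩
    exact h σ hσ hv (hxe ▸ σ.add_mem (hτσ ht) (smul_mem_of_nonneg hv hc))
  rw [starCoord, dif_neg hex]

/-- **Star decomposition inside a cone containing `v`**: every `x ∈ σ ∋ v` is `t + (starCoord v x) v`
with `t` in a cone `τ ∌ v` of `Δ` contained in `σ` (subtract the largest multiple of `v`,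
`exists_isFaceOf_not_mem_mem_sup_ray`). [cite: KempfEtAl1973, I §2 Thm. 11 proof, Lemma 2 (a)] -/
theorem exists_eq_add_starCoord_smul [Fintype κ] {v x : κ → 𝕜} {σ : PointedCone 𝕜 (κ → 𝕜)}
    (hσ : σ ∈ Δ.cones) (hv : v ∈ σ) (hv0 : v ≠ 0) (hx : x ∈ σ) :
    ∃ τ ∈ Δ.cones, v ∉ τ ∧ τ ≤ σ ∧ ∃ t ∈ τ, x = t + Δ.starCoord v x • v := by
  obtain ⟨τ, hτσ, hvτ, hxτ⟩ :=
    exists_isFaceOf_not_mem_mem_sup_ray (Δ.fg hσ) (Δ.salient hσ) hv hv0 hx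
  obtain ⟨t, ht, c, hc, rfl⟩ := mem_sup_ray_iff.mp hxτ
  refine ⟨τ, Δ.face_mem hσ hτσ, hvτ, hτσ.le, t, ht, ?_⟩
  rw [starCoord_eq hσ hv (Δ.face_mem hσ hτσ) hvτ hτσ.le ht hc]

end Fan

end StarCoord

/-! ## Strictly convex support functions on a fan -/

section Support

open Matrix

variable {κ : Type*} [Fintype κ]

/-- **A strictly convex piecewise-linear support function on a fan** `Δ` in `κ → 𝕜` (the
functions "piecewise linear convex rational … such that the associated polyhedra" are the cones,
[KempfEtAl1973] I §2, proof of Thm. 11 (2), and Thm. 10): a function `f` on the ambient space together with a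
linear piece `piece τ` (a vector, paired by the dot product) for every cone `τ` of `Δ`, such that
`f = piece τ · _` on `τ`, `f ≤ piece τ · _` on the support of `Δ` (so `f` is the minimum of its
pieces there: concavity in the `min` convention of `ord`-functions), and the locus where
`f = piece τ · _` is (the carrier of) a cone of `Δ` (strictness: the maximal linearity domains are
cones of the fan). [cite: KempfEtAl1973, I §2 Thm. 10] -/
structure Fan.SupportData (Δ : Fan 𝕜 (κ → 𝕜)) where
  /-- the support function -/
  f : (κ → 𝕜) → 𝕜
  /-- the linear piece of `f` on each cone (as a dual vector for the dot product) -/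
  piece : PointedCone 𝕜 (κ → 𝕜) → (κ → 𝕜)
  /-- `f` agrees with the piece of `τ` on `τ` -/
  eq_piece : ∀ ⦃τ⦄, τ ∈ Δ.cones → ∀ ⦃x⦄, x ∈ τ → f x = piece τ ⬝ᵥ x
  /-- `f` lies below every piece on the support -/
  le_piece : ∀ ⦃τ⦄, τ ∈ Δ.cones → ∀ ⦃x⦄, x ∈ Δ.support → f x ≤ piece τ ⬝ᵥ x
  /-- the linearity locus of every piece is a cone of the fan -/
  exists_domain : ∀ ⦃τ⦄, τ ∈ Δ.cones →
    ∃ ρ ∈ Δ.cones, ∀ x, x ∈ ρ ↔ x ∈ Δ.support ∧ f x = piece τ ⬝ᵥ x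

namespace Fan.SupportData

variable {Δ : Fan 𝕜 (κ → 𝕜)} (D : Δ.SupportData)

open Classical in
/-- The linearity domain of the piece of `τ`: the cone of `Δ` on which `f = piece τ · _`.
[cite: KempfEtAl1973, I §2 Thm. 10] -/
def domain (τ : PointedCone 𝕜 (κ → 𝕜)) : PointedCone 𝕜 (κ → 𝕜) :=
  if h : τ ∈ Δ.cones then (D.exists_domain h).choose else τ

/-- The domain is a cone of the fan. [cite: KempfEtAl1973, I §2 Thm. 10] -/
theorem domain_mem {τ : PointedCone 𝕜 (κ → 𝕜)} (hτ : τ ∈ Δ.cones) : D.domain τ ∈ Δ.cones := by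
  rw [domain, dif_pos hτ]
  exact (D.exists_domain hτ).choose_spec.1

/-- Membership in the domain: `f x = piece τ · x`. [cite: KempfEtAl1973, I §2 Thm. 10] -/
theorem mem_domain_iff {τ : PointedCone 𝕜 (κ → 𝕜)} (hτ : τ ∈ Δ.cones) {x : κ → 𝕜} :
    x ∈ D.domain τ ↔ x ∈ Δ.support ∧ D.f x = D.piece τ ⬝ᵥ x := by
  rw [domain, dif_pos hτ]
  exact (D.exists_domain hτ).choose_spec.2 x

/-- A cone lies in the domain of its piece. [cite: KempfEtAl1973, I §2 Thm. 10] -/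
theorem le_domain {τ : PointedCone 𝕜 (κ → 𝕜)} (hτ : τ ∈ Δ.cones) : τ ≤ D.domain τ :=
  fun _ hx => (D.mem_domain_iff hτ).mpr ⟨Fan.mem_support.mpr ⟨τ, hτ, hx⟩, D.eq_piece hτ hx⟩

/-- Off the domain the piece is strictly above `f`. [cite: KempfEtAl1973, I §2 Thm. 10] -/
theorem lt_piece_of_not_mem_domain {τ : PointedCone 𝕜 (κ → 𝕜)} (hτ : τ ∈ Δ.cones) {x : κ → 𝕜}
    (hx : x ∈ Δ.support) (hxd : x ∉ D.domain τ) : D.f x < D.piece τ ⬝ᵥ x :=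
  lt_of_le_of_ne (D.le_piece hτ hx) fun h => hxd ((D.mem_domain_iff hτ).mpr ⟨hx, h⟩)

/-- `f` is positively homogeneous on the support. [cite: KempfEtAl1973, I §2 Thm. 9 (ii)–(iv)] -/
theorem f_smul {x : κ → 𝕜} (hx : x ∈ Δ.support) {c : 𝕜} (hc : 0 ≤ c) :
    D.f (c • x) = c * D.f x := by
  obtain ⟨τ, hτ, hxτ⟩ := Fan.mem_support.mp hx
  rw [D.eq_piece hτ hxτ, D.eq_piece hτ (smul_mem_of_nonneg hxτ hc), dotProduct_smul, smul_eq_mul]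

/-- `f` is superadditive (concave) on each pair of points of the support whose sum lies in the
support: `f x + f y ≤ f (x + y)`. [cite: KempfEtAl1973, I §2 Thm. 9 (ii)–(iv)] -/
theorem add_le_f {x y : κ → 𝕜} (hx : x ∈ Δ.support) (hy : y ∈ Δ.support)
    (hxy : x + y ∈ Δ.support) : D.f x + D.f y ≤ D.f (x + y) := by
  obtain ⟨τ, hτ, hxyτ⟩ := Fan.mem_support.mp hxy
  rw [D.eq_piece hτ hxyτ, dotProduct_add]
  exact add_le_add (D.le_piece hτ hx) (D.le_piece hτ hy)

end Fan.SupportData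

/-- **The zero support function on the face fan of a cone**: all pieces `0`; the linearity domain
of every piece is `σ` itself. [cite: KempfEtAl1973, I §2 Thm. 11 proof (3)] -/
def Fan.SupportData.ofCone (σ : PointedCone 𝕜 (κ → 𝕜)) (hfg : σ.FG) (hsal : IsSalient σ) :
    (Fan.ofCone σ hfg hsal).SupportData where
  f := fun _ => 0
  piece := fun _ => 0
  eq_piece := fun _ _ _ _ => by rw [zero_dotProduct]
  le_piece := fun _ _ _ _ => by rw [zero_dotProduct]
  exists_domain := fun _ _ =>
    ⟨σ, Fan.self_mem_ofCone hfg hsal, fun x => by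
      rw [zero_dotProduct, Fan.support_ofCone]; simp⟩

end Support

end Literature.Geometry.PolyhedralFans

end
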